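import Literature.NumberTheory.EllipticCurves.EllCurveTorsionGroupScheme
import Literature.NumberTheory.EllipticCurves.KugaSatoVarietyAutomorphismsComm
import HarnessLib

/-!
# A level structure is a homomorphism `(ℤ/N)² → E[N](S)`, bijective on geometric fibres

Topic: `Literature/NumberTheory/EllipticCurves`. Complement to `EllCurveTorsionSubscheme.lean`
and `EllCurveTorsionGroupScheme.lean` (`E[N]` as a commutative `S`-group scheme representing the
`N`-torsion points). Deligne (3.6) defines a level-`n` structure as an isomorphism of group schemes
`α : E_n ⥲ (ℤ/n)²_S`; Katz–Mazur (3.1) as a homomorphism `(ℤ/N)² → E[N](S)` inducing a bijection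
on geometric points (equivalent for `N` invertible, `E[N]` being then finite étale, Katz–Mazur
Thm. 2.3.1). The tree's `EllCurveOver.LevelStructure` (two sections `P, Q` with the fibrewise
basis condition) is the second formulation; this file spells it out in `E[N]`:

* `LevelStructure.torsHom φ : Multiplicative (ℤ/N × ℤ/N) →* Hom_S(S, E[N])` — the homomorphism
  `(a, b) ↦ φ(a, b) = P^a Q^b` with values in the sections of `E[N]` (additivity from
  `LevelStructure.section_add`, for a commutative curve);
* `torsHom_ι` — composed with `ι : E[N] ⟶ E` it is `section_`;
* `restrictTorsHom φ s : Multiplicative (ℤ/N × ℤ/N) →* E[N](s)` for a geometric point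
  `s : Spec Ω → S`, and **`bijective_restrictTorsHom`**: it is a bijection — injective by
  `basis_injective`, surjective by `basis_surjective` (every `Ω`-point of `E[N]` is `N`-torsion in
  `E`); packaged as the group isomorphism
  **`geomFibreEquiv φ s : Multiplicative (ℤ/N × ℤ/N) ≃* E[N](s)`** — Deligne's `α⁻¹` on geometric
  fibres.

Hypothesis `[IsCommMonObj C.E]` (commutativity of the curve, automatic for an elliptic curve; it
makes `E[N]` a group scheme and `P`, `Q` commute). All proved; no named facts; no finiteness or
étaleness of `E[N]` is asserted.

## References

* P. Deligne, *Formes modulaires et représentations ℓ-adiques*, Sém. Bourbaki 355 (1969), (3.6).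
  [Deligne1971Bourbaki355]
* N. Katz, B. Mazur, *Arithmetic moduli of elliptic curves* (1985), (3.1), Thm. 2.3.1.
  [KatzMazur1985]
-/

universe u

open CategoryTheory Limits AlgebraicGeometry MonoidalCategory CartesianMonoidalCategory Opposite
open scoped MonObj

noncomputable section

namespace Literature.NumberTheory.EllipticCurves

namespace EllCurveOver.LevelStructure

variable {S : Scheme.{u}} {C : EllCurveOver S} [IsCommMonObj C.E] {N : ℕ} (φ : LevelStructure N C)

/-- On a commutative curve the basis sections commute. [folklore] -/
theorem commute_PQ : Commute φ.P φ.Q :=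
  Commute.all _ _

/-! ### The level structure as a homomorphism into the sections of `E[N]` -/

/-- **The level structure as a homomorphism `(ℤ/N)² → E[N](S)`**: `(a, b) ↦ φ(a, b) = P^a Q^b`
as a section of `E[N]` (`sectionTors`), additive by `section_add` (Katz–Mazur (3.1): a level
structure is a homomorphism `(ℤ/N)² → E[N](S)`; Deligne (3.6): `α⁻¹`).
[cite: KatzMazur1985, (3.1)] [cite: Deligne1971Bourbaki355, (3.6)] -/
def torsHom [NeZero N] :
    Multiplicative (ZMod N × ZMod N) →* (𝟙_ (Over S) ⟶ KugaSato.torsion C.E N) where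
  toFun u := φ.sectionTors φ.commute_PQ u.toAdd
  map_one' := by
    apply KugaSato.torsion_hom_ext C.E
    rw [sectionTors_ι, toAdd_one, section_zero, MonObj.one_comp]
  map_mul' u v := by
    apply KugaSato.torsion_hom_ext C.E
    rw [sectionTors_ι, toAdd_mul, φ.section_add φ.commute_PQ, MonObj.mul_comp, sectionTors_ι,
      sectionTors_ι]

/-- `torsHom u ≫ ι = φ(u)`. [folklore] -/
@[simp]
theorem torsHom_ι [NeZero N] (u : Multiplicative (ZMod N × ZMod N)) :
    φ.torsHom u ≫ KugaSato.torsionι C.E N = φ.section_ u.toAdd :=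
  φ.sectionTors_ι φ.commute_PQ _

/-! ### Geometric fibres: `(ℤ/N)² ≃ E[N](s)` -/

/-- Restriction of sections of an `S`-group scheme `G` to a point `s` over `S` is a group
homomorphism `G(S) → G(s)` (precomposition preserves products, `MonObj.comp_mul`). [folklore] -/
def sectionsRestrictHom (G : Over S) [GrpObj G] (T : Over S) : (𝟙_ (Over S) ⟶ G) →* (T ⟶ G) where
  toFun P := toUnit T ≫ P
  map_one' := MonObj.comp_one _
  map_mul' P Q := MonObj.comp_mul _ P Q

/-- Unfolding of `sectionsRestrictHom`. [folklore] -/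
@[simp]
theorem sectionsRestrictHom_apply (G : Over S) [GrpObj G] (T : Over S) (P : 𝟙_ (Over S) ⟶ G) :
    sectionsRestrictHom G T P = toUnit T ≫ P :=
  rfl

/-- **The level structure on a geometric fibre**: `(ℤ/N)² → E[N](s)`, `u ↦ φ(u)|_s`, for a point
`s : Spec Ω → S`. [cite: KatzMazur1985, (3.1)] -/
def restrictTorsHom [NeZero N] {Ω : Type u} [Field Ω] (s : Spec (.of Ω) ⟶ S) :
    Multiplicative (ZMod N × ZMod N) →* (Over.mk s ⟶ KugaSato.torsion C.E N) :=
  (sectionsRestrictHom (KugaSato.torsion C.E N) (Over.mk s)).comp φ.torsHom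

/-- Unfolding of `restrictTorsHom`. [folklore] -/
theorem restrictTorsHom_apply [NeZero N] {Ω : Type u} [Field Ω] (s : Spec (.of Ω) ⟶ S)
    (u : Multiplicative (ZMod N × ZMod N)) :
    φ.restrictTorsHom s u = toUnit (Over.mk s) ≫ φ.torsHom u :=
  rfl

/-- `restrictTorsHom u ≫ ι` is the fibre point `φ(u)(s)` of `E`. [folklore] -/
theorem restrictTorsHom_ι [NeZero N] {Ω : Type u} [Field Ω] (s : Spec (.of Ω) ⟶ S)
    (u : Multiplicative (ZMod N × ZMod N)) :
    φ.restrictTorsHom s u ≫ KugaSato.torsionι C.E N = C.restrict s (φ.section_ u.toAdd) := by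
  rw [restrictTorsHom_apply, Category.assoc, torsHom_ι]

/-- **On every geometric fibre the level structure is a bijection `(ℤ/N)² ≃ E[N](s)`**:
injective by the basis condition `basis_injective`, surjective because every `Ω`-point of `E[N]`
is an `N`-torsion point of `E` (`KugaSato.comp_torsionι_pow`) and `basis_surjective`
(Katz–Mazur (3.1); Deligne (3.6): `α` is an isomorphism on geometric fibres).
[cite: KatzMazur1985, (3.1)] [cite: Deligne1971Bourbaki355, (3.6)] -/
theorem bijective_restrictTorsHom [NeZero N] ⦃Ω : Type u⦄ [Field Ω] [IsAlgClosed Ω]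
    (s : Spec (.of Ω) ⟶ S) : Function.Bijective (φ.restrictTorsHom s) := by
  constructor
  · intro u v h
    have h' := φ.sectionTors_injective φ.commute_PQ s
      (show toUnit (Over.mk s) ≫ φ.sectionTors φ.commute_PQ u.toAdd =
        toUnit (Over.mk s) ≫ φ.sectionTors φ.commute_PQ v.toAdd from h)
    exact Multiplicative.toAdd.injective h'
  · intro x
    obtain ⟨ab, hab⟩ := φ.basis_surjective s (x ≫ KugaSato.torsionι C.E N)
      (KugaSato.comp_torsionι_pow C.E N x)
    refine ⟨Multiplicative.ofAdd ab, KugaSato.torsion_hom_ext C.E ?_⟩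
    rw [restrictTorsHom_ι, toAdd_ofAdd]
    exact hab

/-- **Deligne's `α⁻¹` on geometric fibres**: the group isomorphism
`(ℤ/N)² ≃* E[N](s)` attached to a level structure and a geometric point `s : Spec Ω → S`.
[cite: Deligne1971Bourbaki355, (3.6)] [cite: KatzMazur1985, (3.1)] -/
def geomFibreEquiv [NeZero N] {Ω : Type u} [Field Ω] [IsAlgClosed Ω] (s : Spec (.of Ω) ⟶ S) :
    Multiplicative (ZMod N × ZMod N) ≃* (Over.mk s ⟶ KugaSato.torsion C.E N) :=
  MulEquiv.ofBijective (φ.restrictTorsHom s) (φ.bijective_restrictTorsHom s)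

/-- Unfolding of `geomFibreEquiv`. [folklore] -/
@[simp]
theorem geomFibreEquiv_apply [NeZero N] {Ω : Type u} [Field Ω] [IsAlgClosed Ω]
    (s : Spec (.of Ω) ⟶ S) (u : Multiplicative (ZMod N × ZMod N)) :
    φ.geomFibreEquiv s u = φ.restrictTorsHom s u :=
  rfl

include φ in
/-- Consequently, when `E` carries a level-`N` structure, every geometric fibre of `E[N]` has
exactly `N²` points (as a set of `Ω`-points over `s`). [cite: KatzMazur1985, (3.1)] -/
theorem card_geomFibre [NeZero N] {Ω : Type u} [Field Ω] [IsAlgClosed Ω] (s : Spec (.of Ω) ⟶ S) :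
    Nat.card (Over.mk s ⟶ KugaSato.torsion C.E N) = N ^ 2 := by
  rw [← Nat.card_congr (φ.geomFibreEquiv s).toEquiv, Nat.card_eq_fintype_card,
    Fintype.card_multiplicative, Fintype.card_prod, ZMod.card, sq]

end EllCurveOver.LevelStructure

end Literature.NumberTheory.EllipticCurves

end
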